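import Literature.Probability.LatticeModels.MedialInterface
import HarnessLib

/-!
# Measurability of the medial exploration path on `ℤ²`

Companion (theorems only) to `Literature.Probability.LatticeModels.MedialInterface`, the bond /
medial analogue of `Literature.Probability.Percolation.InterfaceScalingLimitMeasurability` (which
treats the hexagonal exploration walk and leaves the medial case aside).

Being the medial exploration path, `IsMedialExploration E ω γ`, depends on the bond configuration
`ω` only through its turning rule, i.e. through the atoms `e ∈ E.bcBondConfig ω` and
`dualEdge e ∈ dualConfig (E.bcBondConfig ω)`, each of which is a measurable event for the product
σ-algebra on `BondConfig (Site 2) = Set (Sym2 (Site 2))` (Mathlib's `measurable_set_mem`). The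
list type `List MedialVertex` is countable, so every fibre `{ω | medialExploration E ω = l}` is a
countable Boolean combination of cylinder events, and hence **every** function of
`medialExploration E ω` is measurable (`measurable_of_medialExploration`) — with no admissibility,
boundedness or `δ > 0` hypothesis on `E` and without any structure on the target. In particular
`medialExplorationCurve E` is Borel measurable, so `medialExplorationLaw E p` is a genuine
push-forward. (Aizenman–Burchard, Duke Math. J. 99 (1999), §2.1: interface laws are Borel
probability measures on the curve space; Smirnov 2001, §2: the exploration path as a random
curve.)

Contents: `measurable_mem_bcBondConfig`, `measurable_dualEdge_mem_dualConfig_bcBondConfig`,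
`measurable_isMedialTurn_bcBondConfig`, `measurable_isMedialExploration`,
`measurableSet_medialExploration_eq`, the factorisation principle `measurable_of_medialExploration`,
`measurable_medialExplorationCurve`.
Not here: the discharge of `Literature.Probability.Percolation.aemeasurable_bondInterface` (one line
from `measurable_of_medialExploration`, but `bondInterface` lives downstream in
`Percolation/InterfaceScalingLimit.lean`).

## References

* M. Aizenman, A. Burchard, *Hölder regularity and dimension bounds for random curves*, Duke
  Math. J. 99 (1999), 419–453, §2.1.
* S. Smirnov, *Critical percolation in the plane*, C. R. Acad. Sci. Paris 333 (2001), §2.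
* G. Grimmett, *Percolation*, 2nd ed. (1999), §11.2 (primal / dual / medial conventions).
-/

noncomputable section

namespace Literature.Probability.LatticeModels

open _root_.MeasureTheory

section Measurability

/-- The status of an edge under the bond Dobrushin boundary condition, `e ∈ E.bcBondConfig ω`, is
a measurable function of the configuration `ω` (it is
`e ∈ E(Ω_δ) ∧ ((∀ x ∈ e, x ∈ A) ∨ (e ∈ ω ∧ ∀ x ∈ e, x ∉ B))`).
(Smirnov 2001, §2; Aizenman–Burchard 1999, §2.1.) [cite: AizenmanBurchard1999, §2.1] -/
theorem measurable_mem_bcBondConfig (E : DiscreteDobrushin) (e : Sym2 (Site 2)) :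
    Measurable fun ω : Percolation.BondConfig (Site 2) => e ∈ E.bcBondConfig ω :=
  show Measurable fun ω : Percolation.BondConfig (Site 2) =>
      e ∈ (discreteDomainGraph E.Ω E.δ).edgeSet ∧
        ((∀ x ∈ e, x ∈ E.zdArcA) ∨ (e ∈ ω ∧ ∀ x ∈ e, x ∉ E.zdArcB)) from
    measurable_const.and (measurable_const.or ((measurable_set_mem e).and measurable_const))

/-- Dual-openness of the dual edge of `e` in the completed configuration,
`dualEdge e ∈ dualConfig (E.bcBondConfig ω)`, is a measurable function of `ω`: by
`Percolation.dualConfig_eq` it is `dualEdge e ∈ E(ℤ²) ∧ dualEdgeEquiv⁻¹ (dualEdge e) ∉ E.bcBondConfig ω`.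
(Grimmett 1999, §11.2; Aizenman–Burchard 1999, §2.1.) [cite: AizenmanBurchard1999, §2.1] -/
theorem measurable_dualEdge_mem_dualConfig_bcBondConfig (E : DiscreteDobrushin)
    (e : Sym2 (Site 2)) :
    Measurable fun ω : Percolation.BondConfig (Site 2) =>
      Percolation.dualEdge e ∈ Percolation.dualConfig (E.bcBondConfig ω) := by
  have h : (fun ω : Percolation.BondConfig (Site 2) =>
      Percolation.dualEdge e ∈ Percolation.dualConfig (E.bcBondConfig ω)) =
      fun ω => Percolation.dualEdge e ∈ (zdGraph 2).edgeSet ∧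
        ¬ (Percolation.dualEdgeEquiv.symm (Percolation.dualEdge e) ∈ E.bcBondConfig ω) := by
    funext ω
    rw [Percolation.dualConfig_eq]
    rfl
  rw [h]
  exact measurable_const.and (measurable_mem_bcBondConfig E _).not

/-- The turning rule `IsMedialTurn (E.bcBondConfig ω) e₀ e₁ e₂` of the completed configuration at a
medial vertex is a measurable event of `ω` (a countable union over pairs of corners of events built
from the two atoms above; cf. `Literature.Probability.Percolation.measurable_isMedialTurn` for the
raw configuration). (Smirnov 2001, §2; Aizenman–Burchard 1999, §2.1.) [cite: AizenmanBurchard1999, §2.1] -/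
theorem measurable_isMedialTurn_bcBondConfig (E : DiscreteDobrushin) (e₀ e₁ e₂ : MedialVertex) :
    Measurable fun ω : Percolation.BondConfig (Site 2) =>
      IsMedialTurn (E.bcBondConfig ω) e₀ e₁ e₂ := by
  unfold IsMedialTurn
  exact Measurable.exists fun v₁ => Measurable.exists fun f₁ => Measurable.exists fun v₂ =>
    Measurable.exists fun f₂ => measurable_const.and <| measurable_const.and <|
    measurable_const.and <| measurable_const.and <| measurable_const.and <| measurable_const.and <|
    (measurable_const.and (measurable_dualEdge_mem_dualConfig_bcBondConfig E e₁)).or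
      (measurable_const.and (measurable_mem_bcBondConfig E e₁))

/-- Being the medial exploration path is a measurable event, for every fixed list `γ`: all fields
of `IsMedialExploration E ω γ` except the turning rule are `ω`-free, and the turning rule is a
countable intersection of the events `measurable_isMedialTurn_bcBondConfig`.
(Smirnov 2001, §2; Aizenman–Burchard 1999, §2.1.) [cite: AizenmanBurchard1999, §2.1] -/
theorem measurable_isMedialExploration (E : DiscreteDobrushin) (γ : List MedialVertex) :
    Measurable fun ω : Percolation.BondConfig (Site 2) => IsMedialExploration E ω γ := by
  have h : (fun ω : Percolation.BondConfig (Site 2) => IsMedialExploration E ω γ) = fun ω =>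
      (∃ hne : γ ≠ [], (∀ e e', [e, e'] <:+: γ → E.IsMedialStep e e') ∧ (γ.zip γ.tail).Nodup ∧
        γ.head hne ∈ E.zdABEdges ∧ γ.getLast hne ∈ E.zdABEdges ∧ γ.head hne ≠ γ.getLast hne ∧
        (∀ e e', [e, e'] <+: γ → ∃ v f, IsCorner v f ∧ cornerSource v f = e ∧
          cornerTarget v f = e' ∧ v ∈ E.zdArcA)) ∧
      ∀ e₀ e₁ e₂, [e₀, e₁, e₂] <:+: γ → IsMedialTurn (E.bcBondConfig ω) e₀ e₁ e₂ := by
    funext ω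
    exact propext ⟨fun ⟨h1, h2, h3, h4, h5, h6, h7, h8⟩ => ⟨⟨h1, h2, h4, h5, h6, h7, h8⟩, h3⟩,
      fun ⟨⟨h1, h2, h4, h5, h6, h7, h8⟩, h3⟩ => ⟨h1, h2, h3, h4, h5, h6, h7, h8⟩⟩
  rw [h]
  exact measurable_const.and (Measurable.forall fun e₀ => Measurable.forall fun e₁ =>
    Measurable.forall fun e₂ =>
      measurable_const.imp (measurable_isMedialTurn_bcBondConfig E e₀ e₁ e₂))

/-- Every fibre `{ω | medialExploration E ω = l}` of the medial exploration is a measurable event: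
with `U l ω :=` "`l` is an exploration path of `ω` and every exploration path of `ω` equals `l`",
the fibre is `{ω | U l ω ∨ ((¬ ∃ l', U l' ω) ∧ l = [])}` (the second disjunct is the junk branch
of `medialExploration`), a countable Boolean combination of the events
`measurable_isMedialExploration`. (Smirnov 2001, §2; Aizenman–Burchard 1999, §2.1.) [cite: AizenmanBurchard1999, §2.1] -/
theorem measurableSet_medialExploration_eq (E : DiscreteDobrushin) (l : List MedialVertex) :
    MeasurableSet {ω : Percolation.BondConfig (Site 2) | medialExploration E ω = l} := by
  classical
  have hU : ∀ l : List MedialVertex, Measurable fun ω : Percolation.BondConfig (Site 2) =>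
      IsMedialExploration E ω l ∧ ∀ l', IsMedialExploration E ω l' → l' = l := fun l =>
    (measurable_isMedialExploration E l).and
      (Measurable.forall fun l' => (measurable_isMedialExploration E l').imp measurable_const)
  have hset : {ω : Percolation.BondConfig (Site 2) | medialExploration E ω = l} =
      {ω | (IsMedialExploration E ω l ∧ ∀ l', IsMedialExploration E ω l' → l' = l) ∨
        ((¬ ∃ l₀, IsMedialExploration E ω l₀ ∧ ∀ l', IsMedialExploration E ω l' → l' = l₀) ∧
          l = [])} := by
    ext ω
    simp only [Set.mem_setOf_eq]
    unfold medialExploration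
    by_cases h : ∃! γ : List MedialVertex, IsMedialExploration E ω γ
    · rw [dif_pos h]
      refine ⟨fun hl => ?_, fun hl => ?_⟩
      · subst hl
        exact Or.inl ⟨h.exists.choose_spec, fun l' hl' => h.unique hl' h.exists.choose_spec⟩
      · rcases hl with hl | ⟨hno, -⟩
        · exact h.unique h.exists.choose_spec hl.1
        · exact (hno h).elim
    · rw [dif_neg h]
      refine ⟨fun hl => Or.inr ⟨h, hl.symm⟩, fun hl => ?_⟩
      rcases hl with hl | ⟨-, hl⟩
      · exact (h ⟨l, hl.1, hl.2⟩).elim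
      · exact hl.symm
  rw [hset]
  exact ((hU l).or ((Measurable.exists hU).not.and measurable_const)).setOf

/-- **Factorisation principle.** Any function of the bond configuration that depends on `ω` only
through the medial exploration `medialExploration E ω` is measurable: the list type is countable
and the fibres are measurable (`measurableSet_medialExploration_eq`), so the function is the
composition of a measurable map into a countable discrete space with an arbitrary map. No
hypothesis on `E` and no structure on the target are needed.
(Aizenman–Burchard 1999, §2.1; Smirnov 2001, §2.) [cite: AizenmanBurchard1999, §2.1] -/
theorem measurable_of_medialExploration {X : Type*} [MeasurableSpace X] (E : DiscreteDobrushin)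
    {F : Percolation.BondConfig (Site 2) → X}
    (hF : ∀ ω ω', medialExploration E ω = medialExploration E ω' → F ω = F ω') :
    Measurable F := by
  classical
  letI : MeasurableSpace (List MedialVertex) := ⊤
  let g : List MedialVertex → X := fun l =>
    F (if h : ∃ ω, medialExploration E ω = l then h.choose else ∅)
  have hFg : F = g ∘ medialExploration E := by
    funext ω
    have h : ∃ ω', medialExploration E ω' = medialExploration E ω := ⟨ω, rfl⟩
    simp only [Function.comp_apply, g, dif_pos h]
    exact hF _ _ h.choose_spec.symm
  rw [hFg]
  exact measurable_from_top.comp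
    (measurable_to_countable' fun l => measurableSet_medialExploration_eq E l)

/-- Configurations with the same medial exploration have the same medial exploration curve.
(Smirnov 2001, §2.) [cite: Smirnov2001, §2] -/
theorem medialExplorationCurve_congr {E : DiscreteDobrushin} {ω ω' : Percolation.BondConfig (Site 2)}
    (h : medialExploration E ω = medialExploration E ω') :
    medialExplorationCurve E ω = medialExplorationCurve E ω' := by
  unfold medialExplorationCurve
  rw [h]

/-- The medial exploration curve `medialExplorationCurve E : BondConfig (Site 2) → C([0,1], ℂ)` is
measurable for the Borel σ-algebra of the uniform topology (`curveMeasurableSpace`), for every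
`E` — so `medialExplorationLaw E p` is a genuine push-forward.
(Smirnov 2001, §2; Aizenman–Burchard 1999, §2.1.) [cite: AizenmanBurchard1999, §2.1] -/
theorem measurable_medialExplorationCurve (E : DiscreteDobrushin) :
    Measurable (medialExplorationCurve E) :=
  measurable_of_medialExploration E fun _ _ h => medialExplorationCurve_congr h

end Measurability

end Literature.Probability.LatticeModels

end
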